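import Mathlib
import Summits.NavierStokesRegularity.NavierStokesRegularity.Theorems.TaoLadderRungTwoBreakNoSurvivingEternalViscBddOneContinuumCharacteristic

/-!
# Crux `TaoLadderRungTwoBreak.NoSurvivingEternalViscBddOne` (stmt-NavierStokesRegularity-20419), remaining lemma (W1b):
# ENTROPY SHOCKS CANNOT REPLACE THE SONIC REGULARITY — Kolmogorov selection for continuum fronts with singular wakes

MODEL/heuristic layer only (the continuum limit `∂_τE + ∂_y(2e^{y}E^{3/2}) = 0` of the positive dyadic lattice, tree
`…ContinuumCharacteristic`); nothing here is a statement about the Navier–Stokes equations or about the lattice items,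
and no stub, crux, rung or summit is proved (`--supports stmt-NavierStokesRegularity-20419 --as helper`).

The tree's selection theorem `similarity_exponent_selection` pins the similarity exponents `(a,b) = (1, 3/2)` (wake rate
`2/3`, Kolmogorov, against the (S₁) threshold `2/5`) for SHOCK-FREE wakes: a profile continuous on the whole wake and
differentiable at every interior point is sonic somewhere (intermediate value theorem) and `C¹` at the sonic point
forces `a = 2b/3`.  The loophole it leaves is a wake carrying further discontinuities.  This file closes it for ENTROPY
solutions: the selection needs NO global continuity, only

* the profile equation, positivity and differentiability at every wake point OUTSIDE an arbitrary singular set `S`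
  (any set — not assumed finite, closed or discrete), and
* at every singular point `s ∈ S` inside the wake, the state immediately AHEAD of it (towards the front, `η ↓ s`) is
  strictly SUBSONIC, `3e^{η}√G(η) < b` on some `(s, s+δ)` — the downstream half of the Lax entropy condition for the
  convex flux `2e^{η}G^{3/2}` in the frame of speed `b` (characteristics run INTO an admissible shock: supersonic behind,
  subsonic ahead).

`exists_sonic_regular_point` — under these hypotheses, with the front state supersonic on a left-neighbourhood of `η'`
and the far wake subsonic, there is a REGULAR (non-singular) wake point that is exactly sonic: the supremum `ξ*` of the
subsonic-or-sonic wake points is not singular (a singular point has subsonic points just ahead of it, above the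
supremum), is not near the front (supersonic there), and continuity at `ξ*` rules out both strict signs.
`similarity_exponent_selection_entropy` — hence `a = 2b/3`, and in the similarity class `b = 1 + a/2`:
`(a, b) = (1, 3/2)`, wake rate `a/b = 2/3 > 2/5`.  `similarity_exponent_selection_of_continuousOn` recovers the tree's
shock-free statement as the case `S = ∅`.
READING for (W1): in the continuum limit an (S₁)-surviving front (`a ≤ 1/2`, tree `wake_rate_le_threshold_iff`,
`surviving_one_iff_frontExponent`) needs a wake singularity that is SUPERSONIC immediately ahead of itself — an
expansion (entropy-violating) discontinuity or a fold; admissible (Lax) shocks in the wake, however many, do not help.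
What a lattice → continuum theorem (W1a) must therefore deliver is only the one-sided entropy sign at wake
singularities of the limit, not continuity of the limit profile.

HONEST LABEL: elementary real analysis (a supremum argument) on top of the tree's `sonic_selection`; records the
mechanism, proves nothing about any item; ⟨20419⟩, its children and every NS statement remain OPEN.
-/

noncomputable section

-- the summit and its single sub-problem share the name (CONVENTIONS §1)
set_option linter.dupNamespace false

namespace Summit.NavierStokesRegularity.NavierStokesRegularity.Theorems.NoSurvivingEternalViscBddOne.Continuum

open Real Filter Topology Set

/-- **A sonic REGULAR point exists even with entropy shocks in the wake.**  Let `c(η) = 3e^{η}√G(η)` be the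
characteristic speed and `b` the frame speed.  Assume: the wake is subsonic far back (`c < b` on `(-∞, η₂]`, some
`η₂ < η'`), supersonic just behind the front (`b < c` on `(η' - δ, η')`), `G` is continuous at every point of
`(-∞, η')` outside a set `S`, and every point of `S` below `η'` has strictly subsonic points immediately ahead of it
(`c < b` on some `(s, s + δ')`: the downstream Lax sign).  Then some point `ξ < η'` OUTSIDE `S` is exactly sonic,
`c(ξ) = b`.
[folklore (intermediate value argument with one-sided jump conditions; Lax entropy condition for a convex scalar conservation law); cell memo W1] -/
theorem exists_sonic_regular_point {G : ℝ → ℝ} {S : Set ℝ} {b η' η₂ δ : ℝ} (hη₂ : η₂ < η')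
    (hsub : ∀ η, η ≤ η₂ → 3 * exp η * sqrt (G η) < b)
    (hδ : 0 < δ) (hsup : ∀ η, η' - δ < η → η < η' → b < 3 * exp η * sqrt (G η))
    (hcont : ∀ η, η < η' → η ∉ S → ContinuousAt G η)
    (hlax : ∀ s ∈ S, s < η' → ∃ δ' > 0, ∀ η, s < η → η < s + δ' → 3 * exp η * sqrt (G η) < b) :
    ∃ ξ, ξ < η' ∧ ξ ∉ S ∧ 3 * exp ξ * sqrt (G ξ) = b := by
  set c : ℝ → ℝ := fun η => 3 * exp η * sqrt (G η) with hc
  set A : Set ℝ := {η | η < η' ∧ c η ≤ b} with hA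
  have hη₂A : η₂ ∈ A := ⟨hη₂, (hsub η₂ le_rfl).le⟩
  have hAne : A.Nonempty := ⟨η₂, hη₂A⟩
  -- every element of `A` is `≤ η' - δ` (the front layer is supersonic)
  have hAle : ∀ η ∈ A, η ≤ η' - δ := by
    intro η hη
    by_contra h
    push Not at h
    exact absurd hη.2 (not_le.2 (hsup η h hη.1))
  have hAbdd : BddAbove A := ⟨η' - δ, hAle⟩
  set ξ := sSup A with hξ
  have hξle : ξ ≤ η' - δ := csSup_le hAne hAle
  have hξlt : ξ < η' := by linarith
  have hξge : η₂ ≤ ξ := le_csSup hAbdd hη₂A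
  -- no point of `A` lies above `ξ`
  have hnotabove : ∀ η, ξ < η → η < η' → b < c η := by
    intro η h1 h2
    by_contra h
    push Not at h
    have : η ≤ ξ := le_csSup hAbdd ⟨h2, h⟩
    linarith
  -- `ξ` is not a singular point: a singular point has subsonic points just ahead of it
  have hξS : ξ ∉ S := by
    intro hmem
    obtain ⟨δ', hδ', hlt⟩ := hlax ξ hmem hξlt
    set η := min (ξ + δ' / 2) ((ξ + η') / 2) with hηdef
    have h1 : ξ < η := by
      rw [hηdef]; exact lt_min (by linarith) (by linarith)
    have h2 : η < η' := lt_of_le_of_lt (min_le_right _ _) (by linarith)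
    have h3 : η < ξ + δ' := lt_of_le_of_lt (min_le_left _ _) (by linarith)
    exact absurd (hlt η h1 h3) (not_lt.2 (hnotabove η h1 h2).le)
  -- `c` is continuous at `ξ`
  have hcξ : ContinuousAt c ξ := by
    have hG := hcont ξ hξlt hξS
    exact ((continuous_const.mul Real.continuous_exp).continuousAt).mul hG.sqrt
  refine ⟨ξ, hξlt, hξS, ?_⟩
  rcases lt_trichotomy (c ξ) b with hlt | heq | hgt
  · -- strictly subsonic at `ξ`: then also slightly ahead of `ξ`, contradicting the supremum
    exfalso
    have hev : ∀ᶠ η in 𝓝 ξ, c η < b := hcξ.eventually (gt_mem_nhds hlt)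
    obtain ⟨ρ, hρ, hball⟩ := Metric.eventually_nhds_iff.1 hev
    set η := min (ξ + ρ / 2) ((ξ + η') / 2) with hηdef
    have h1 : ξ < η := by
      rw [hηdef]; exact lt_min (by linarith) (by linarith)
    have h2 : η < η' := lt_of_le_of_lt (min_le_right _ _) (by linarith)
    have h3 : dist η ξ < ρ := by
      rw [Real.dist_eq, abs_of_pos (by linarith)]
      have : η ≤ ξ + ρ / 2 := min_le_left _ _
      linarith
    exact absurd (hball h3) (not_lt.2 (hnotabove η h1 h2).le)
  · exact heq
  · -- strictly supersonic at `ξ`: then on a neighbourhood, so `A` stays below `ξ - ρ`, contradicting the supremum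
    exfalso
    have hev : ∀ᶠ η in 𝓝 ξ, b < c η := hcξ.eventually (lt_mem_nhds hgt)
    obtain ⟨ρ, hρ, hball⟩ := Metric.eventually_nhds_iff.1 hev
    have hAle' : ∀ η ∈ A, η ≤ ξ - ρ := by
      intro η hη
      by_contra h
      push Not at h
      have hηξ : η ≤ ξ := le_csSup hAbdd hη
      have hd : dist η ξ < ρ := by
        rw [Real.dist_eq, abs_of_nonpos (by linarith)]
        linarith
      exact absurd hη.2 (not_le.2 (hball hd))
    have : ξ ≤ ξ - ρ := csSup_le hAne hAle'
    linarith

/-- **KOLMOGOROV SELECTION WITH ENTROPY SHOCKS IN THE WAKE.**  Let `G` be a similarity profile with exponents `(a, b)`,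
`b > 0`, in the class `b = 1 + a/2`, supersonic just behind the front `η'` (`b < 3e^{η}√G` on `(η'-δ, η')`, e.g. by
`front_state_supersonic` and one-sided continuity), decaying like `e^{-γη}`, `γ < 2`, far back, and REGULAR OFF A
SINGULAR SET `S`: at every wake point `η < η'` outside `S` the profile is continuous, positive, differentiable and obeys
the conservative profile equation `(2e^{η}G√G - bG)' = aG`; at every singular point of the wake the state immediately
AHEAD is strictly subsonic (downstream Lax sign of an admissible shock).  Then `a = 1`, `b = 3/2`, wake rate
`a/b = 2/3 > 2/5`: admissible shocks in the wake, however many and wherever placed, do not relax the selection — an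
(S₁)-surviving continuum front (`a ≤ 1/2`) needs a wake singularity that is supersonic immediately ahead of itself
(entropy-violating).
[folklore (self-similar solutions of the second kind, cf. Barenblatt 1979, Ch. 4; Lax entropy condition); cell memo W1] -/
theorem similarity_exponent_selection_entropy {G : ℝ → ℝ} {S : Set ℝ} {a b C γ η₁ η' δ : ℝ} (hb : 0 < b)
    (hbal : b = 1 + a / 2) (hδ : 0 < δ)
    (hsup : ∀ η, η' - δ < η → η < η' → b < 3 * exp η * sqrt (G η))
    (hC : 0 ≤ C) (hγ : γ < 2) (hdecay : ∀ η, η ≤ η₁ → G η ≤ C * exp (-γ * η))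
    (hreg : ∀ η, η < η' → η ∉ S → ContinuousAt G η ∧ 0 < G η ∧ ∃ g : ℝ, HasDerivAt G g η ∧
      HasDerivAt (fun x => 2 * exp x * (G x * sqrt (G x)) - b * G x) (a * G η) η)
    (hlax : ∀ s ∈ S, s < η' → ∃ δ' > 0, ∀ η, s < η → η < s + δ' → 3 * exp η * sqrt (G η) < b) :
    a = 1 ∧ b = 3 / 2 ∧ a / b = 2 / 3 ∧ (2 : ℝ) / 5 < a / b := by
  obtain ⟨η₂, hη₂, hsub⟩ := wake_eventually_subsonic hC hγ hb hdecay
  -- a subsonic point strictly below the front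
  set η₃ := min η₂ (η' - δ) with hη₃
  have hη₃lt : η₃ < η' := lt_of_le_of_lt (min_le_right _ _) (by linarith)
  have hsub' : ∀ η, η ≤ η₃ → 3 * exp η * sqrt (G η) < b :=
    fun η hη => hsub η (hη.trans (min_le_left _ _))
  obtain ⟨ξ, hξlt, hξS, hson⟩ := exists_sonic_regular_point hη₃lt hsub' hδ hsup
    (fun η hη hS => (hreg η hη hS).1) hlax
  obtain ⟨_, hpos, g, hG, hΦ⟩ := hreg ξ hξlt hξS
  have hsel := sonic_selection hG hpos hΦ hson
  obtain ⟨ha, hb', hγ'⟩ := exponents_of_sonic_selection hsel hbal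
  exact ⟨ha, hb', hγ', by rw [hγ']; norm_num⟩

/-- **The shock-free case recovered** (`S = ∅`, continuity from the left at the front turning the supersonic VALUE at
`η'` into a supersonic left-neighbourhood): the hypotheses of the tree's `similarity_exponent_selection` imply those of
`similarity_exponent_selection_entropy`, so the latter is a genuine extension.
[folklore; cell memo W1] -/
theorem similarity_exponent_selection_of_continuousOn {G : ℝ → ℝ} {a b C γ η₁ η' : ℝ} (hb : 0 < b)
    (hbal : b = 1 + a / 2) (hcont : ContinuousOn G (Iic η')) (hsup : b < 3 * exp η' * sqrt (G η'))
    (hC : 0 ≤ C) (hγ : γ < 2) (hdecay : ∀ η, η ≤ η₁ → G η ≤ C * exp (-γ * η))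
    (hpos : ∀ η, η < η' → 0 < G η)
    (hode : ∀ η, η < η' → ∃ g : ℝ, HasDerivAt G g η ∧
      HasDerivAt (fun x => 2 * exp x * (G x * sqrt (G x)) - b * G x) (a * G η) η) :
    a = 1 ∧ b = 3 / 2 ∧ a / b = 2 / 3 ∧ (2 : ℝ) / 5 < a / b := by
  -- continuity of the characteristic speed within the wake at the front point
  have hc : ContinuousWithinAt (fun η => 3 * exp η * sqrt (G η)) (Iic η') η' := by
    have hG : ContinuousWithinAt G (Iic η') η' := hcont η' self_mem_Iic
    exact ((continuous_const.mul Real.continuous_exp).continuousWithinAt).mul hG.sqrt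
  have hev : ∀ᶠ η in 𝓝[Iic η'] η', b < 3 * exp η * sqrt (G η) := hc.eventually (lt_mem_nhds hsup)
  obtain ⟨δ, hδ, hball⟩ := Metric.eventually_nhds_iff.1 (eventually_nhdsWithin_iff.1 hev)
  have hsup' : ∀ η, η' - δ < η → η < η' → b < 3 * exp η * sqrt (G η) := by
    intro η h1 h2
    have hd : dist η η' < δ := by
      rw [Real.dist_eq, abs_of_neg (by linarith)]; linarith
    exact hball hd h2.le
  refine similarity_exponent_selection_entropy (S := ∅) hb hbal hδ hsup' hC hγ hdecay ?_ ?_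
  · intro η hη _
    refine ⟨?_, hpos η hη, hode η hη⟩
    exact (hcont η (le_of_lt hη)).continuousAt (Iic_mem_nhds hη)
  · intro s hs; exact absurd hs (Set.notMem_empty s)


/-! ### Appended (leafhand 4-g11, same session): Rankine–Hugoniot conjugate states straddle the sonic line

At a discontinuity of a weak similarity profile the conservative quantity `2e^{η}G√G − bG` is continuous
(Rankine–Hugoniot in the frame of speed `b`; the source `aG` is bounded).  For fixed `η` the function
`G ↦ 2e^{η}G^{3/2} − bG` is strictly convex on `[0,∞)` with derivative `3e^{η}√G − b = c − b`, so two DISTINCT states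
with the same value lie on opposite sides of the sonic line: the smaller one is subsonic, the larger one supersonic.
Consequently every wake discontinuity is of exactly one of two kinds: the amplitude DROPS toward the front (ahead state
smaller, hence subsonic ahead — a Lax shock, the hypothesis of `similarity_exponent_selection_entropy` holds there) or the
amplitude JUMPS UP toward the front (ahead state larger, hence supersonic ahead — anti-Lax, an expansion discontinuity).
With `similarity_exponent_selection_entropy` this makes the continuum dichotomy exact: a similarity front escapes the
Kolmogorov selection ONLY through an upward (expansion) jump somewhere in its wake. -/

/-- **Rankine–Hugoniot conjugate states straddle the sonic line.**  If `0 ≤ G₁ < G₂` carry the same relative flux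
`2e^{η}G√G − bG` at the same place `η`, then `3e^{η}√G₁ < b < 3e^{η}√G₂`: the smaller state is strictly subsonic and
the larger strictly supersonic (strict convexity of `G ↦ 2e^{η}G^{3/2} − bG`).
[folklore (Rankine–Hugoniot / Lax for a convex scalar conservation law); cell memo W1] -/
theorem conjugate_states_straddle_sonic {G₁ G₂ b η : ℝ} (hG₁ : 0 ≤ G₁) (hlt : G₁ < G₂)
    (hRH : 2 * exp η * (G₁ * sqrt G₁) - b * G₁ = 2 * exp η * (G₂ * sqrt G₂) - b * G₂) :
    3 * exp η * sqrt G₁ < b ∧ b < 3 * exp η * sqrt G₂ := by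
  have hG₂ : 0 ≤ G₂ := hG₁.trans hlt.le
  set s₁ := sqrt G₁ with hs₁
  set s₂ := sqrt G₂ with hs₂
  set E := exp η with hE
  have hEpos : 0 < E := exp_pos η
  have hs₁nn : 0 ≤ s₁ := sqrt_nonneg _
  have hs₂nn : 0 ≤ s₂ := sqrt_nonneg _
  have h1 : G₁ = s₁ ^ 2 := (sq_sqrt hG₁).symm
  have h2 : G₂ = s₂ ^ 2 := (sq_sqrt hG₂).symm
  have hs12 : s₁ < s₂ := by
    rw [hs₁, hs₂]; exact Real.sqrt_lt_sqrt hG₁ hlt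
  rw [h1, h2] at hRH
  -- factor the Rankine–Hugoniot relation by `s₂ - s₁ ≠ 0`
  have hfac : (s₂ - s₁) * (2 * E * (s₂ ^ 2 + s₁ * s₂ + s₁ ^ 2) - b * (s₂ + s₁)) = 0 := by
    linear_combination (-1 : ℝ) * hRH
  have hne : s₂ - s₁ ≠ 0 := sub_ne_zero.2 (ne_of_gt hs12)
  have hkey : 2 * E * (s₂ ^ 2 + s₁ * s₂ + s₁ ^ 2) = b * (s₂ + s₁) := by
    have := (mul_eq_zero.1 hfac).resolve_left hne
    linarith
  have hsum : 0 < s₂ + s₁ := by linarith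
  have hd : 0 < s₂ - s₁ := sub_pos.2 hs12
  constructor
  · -- `3E s₁ < b`: else `b(s₁+s₂) ≤ 3E s₁(s₁+s₂) < 2E(s₂²+s₁s₂+s₁²)`
    by_contra h
    push Not at h
    have hA : 0 < E * ((s₂ - s₁) * (2 * s₂ + s₁)) := mul_pos hEpos (mul_pos hd (by linarith))
    nlinarith [mul_le_mul_of_nonneg_right h hsum.le]
  · -- `b < 3E s₂`: else `2E(s₂²+s₁s₂+s₁²) = b(s₁+s₂) ≥ 3E s₂(s₁+s₂)`
    by_contra h
    push Not at h
    have hA : 0 < E * ((s₂ - s₁) * (2 * s₁ + s₂)) := mul_pos hEpos (mul_pos hd (by linarith))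
    nlinarith [mul_le_mul_of_nonneg_right h hsum.le]

/-- **Lax ⟺ the amplitude drops toward the front.**  At a wake discontinuity with Rankine–Hugoniot-conjugate, distinct,
non-negative states `Gb` (behind) and `Ga` (ahead): the state ahead is strictly subsonic — the downstream Lax sign
required by `similarity_exponent_selection_entropy` — if and only if `Ga < Gb`; otherwise (`Gb < Ga`, an upward jump
toward the front) the state ahead is strictly SUPERSONIC (expansion discontinuity).
[folklore (Lax entropy condition for a convex scalar conservation law); cell memo W1] -/
theorem subsonic_ahead_iff_amplitude_drops {Gb Ga b η : ℝ} (hGb : 0 ≤ Gb) (hGa : 0 ≤ Ga) (hne : Ga ≠ Gb)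
    (hRH : 2 * exp η * (Gb * sqrt Gb) - b * Gb = 2 * exp η * (Ga * sqrt Ga) - b * Ga) :
    3 * exp η * sqrt Ga < b ↔ Ga < Gb := by
  rcases lt_or_gt_of_ne hne with hlt | hgt
  · -- ahead smaller: subsonic ahead (Lax)
    exact ⟨fun _ => hlt, fun _ => (conjugate_states_straddle_sonic hGa hlt hRH.symm).1⟩
  · -- ahead larger: supersonic ahead (anti-Lax)
    have h := (conjugate_states_straddle_sonic hGb hgt hRH).2
    exact ⟨fun h' => absurd h' (not_lt.2 h.le), fun h' => absurd h' (not_lt.2 hgt.le)⟩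

/-- **The upward jump is supersonic ahead** (the anti-Lax case spelled out): if the state ahead is the larger of two
Rankine–Hugoniot-conjugate non-negative states, it is strictly supersonic, so the downstream Lax sign FAILS there — this
is the only way a similarity front can escape `similarity_exponent_selection_entropy`.
[folklore; cell memo W1] -/
theorem supersonic_ahead_of_upward_jump {Gb Ga b η : ℝ} (hGb : 0 ≤ Gb) (hup : Gb < Ga)
    (hRH : 2 * exp η * (Gb * sqrt Gb) - b * Gb = 2 * exp η * (Ga * sqrt Ga) - b * Ga) :
    b < 3 * exp η * sqrt Ga ∧ 3 * exp η * sqrt Gb < b :=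
  ⟨(conjugate_states_straddle_sonic hGb hup hRH).2, (conjugate_states_straddle_sonic hGb hup hRH).1⟩

end Summit.NavierStokesRegularity.NavierStokesRegularity.Theorems.NoSurvivingEternalViscBddOne.Continuum

end
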